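import Summits.ABC.StewartYu.RecordNumericC
import HarnessLib

/-!
# Cell abc-stewartyu, Gen-3 record (WP-M3.R): clause (C) of the record from SIX scalar facts — record-agnostic
# (for the v2 family `PadicG3ParG` in the gain-divided scale `Lg`, and any later re-instantiation)

`Summits/ABC/StewartYu/RecordExitCGeneric.lean` — cell `abc-stewartyu` (HOME `run/shared/lean/pub/abc-stewartyu/`),
route `PadicPrimesKummerThird`, cruxes `Y07Odd` (stmt-ABC-19658) / `Y07Two` (stmt-ABC-19659); seat lp-1 (g2).
Theorems only.

`PadicG3ExitC` / `PadicG3ClauseC` (p485754, p486681) prove clause (C) for the v1 record from its definitions; the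
proofs use only six scalar facts about the END data, isolated here with the box scale `L` a free real
(v2: `L := Lg = ⌈L_G/g⌉`, STATUS lp-1 2026-08-27T03:0xZ):

  `16(n+1)L < (S₀+1)(n+2)⁴`, `2^{n+22}·K·X ≤ 2X_f+1`, `Λ ≤ λ(n)·L`, `L ≤ c_L(n)·K·Ω`, `D₀ ≤ X·L/2`, `1 ≤ D₀`

(`λ(n) = (2^{n+23})⁻¹ + 2ⁿ/(24Cbⁿ)`, `c_L(n) = 264Cbⁿ + 2^{2n+26}`, `Ω = ∏ V j`), plus the weights' floors
`1 ≤ V j ≤ Vmax`, `1 ≤ W`.  The constant comparisons `NC1/NC0` are the landed `PadicG3Par.hnum1_holds/hnum0_holds`.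

* `Q_mul_le_one_of`, `Q_mul_le_zero_of` — `Pmax(r,d₀)·(14n+3) ≤ 256^{n−r}·Ω`;
* `bracket_le_of`, `clauseC_final_of`, `Q_pos_of`;
* `exitC_two_of`, `exitC_odd_of` — the `hCineq` hypotheses of `RecordAssembly.recordTwo_of_ineqs` /
  `recordOdd_of_ineqs` VERBATIM for `(V, Vmax, W, D₀, S₀, X_f, Λ)` and any admissible `C`
  (`0 ≤ C r`, `256^{n−r}C r ≤ C n`).

References: Yu. V. Nesterenko, LNM 1819 (2003), §5.2 (5.21)–(5.22).
-/

noncomputable section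

open Finset Real Nat

namespace Summit.ABC.StewartYu

namespace RecordExitsNumeric

open PadicG3Par (Cb sixtyfour_le_Cb hnum1_holds hnum0_holds)

/-- `Ω = ∏ V ≤ Vmaxⁿ` (`0 ≤ V j ≤ Vmax`). [folklore] -/
theorem prod_le_pow_of {n : ℕ} {V : Fin n → ℝ} {Vmax : ℝ} (hV0 : ∀ j, 0 ≤ V j) (hVmax : ∀ j, V j ≤ Vmax) :
    ∏ j, V j ≤ Vmax ^ n := by
  calc ∏ j, V j ≤ ∏ _j : Fin n, Vmax := prod_le_prod (fun j _ => hV0 j) fun j _ => hVmax j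
    _ = Vmax ^ n := by rw [prod_const, Finset.card_univ, Fintype.card_fin]

/-- **The logarithmic bracket** (generic weights): if `0 < Q`, `Q·(14n+3) ≤ 256^{n−r}·Ω`, `1 ≤ W`, `1 ≤ V j ≤ Vmax`,
`0 ≤ E`, then `W + log 3 + log n + log Vmax + log Q + E + log 2Q ≤ (14n+3)(W + E + log 2Vmax)`. [folklore] -/
theorem bracket_le_of {n : ℕ} (hn : 1 ≤ n) {V : Fin n → ℝ} {Vmax W : ℝ} (hV1 : ∀ j, 1 ≤ V j)
    (hVmax : ∀ j, V j ≤ Vmax) (hVmax1 : 1 ≤ Vmax) (hW : 1 ≤ W) {r : ℕ} {Q E : ℝ} (hQ0 : 0 < Q) (hE : 0 ≤ E)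
    (hQ : Q * (14 * n + 3) ≤ (256 : ℝ) ^ (n - r) * ∏ j, V j) :
    W + Real.log 3 + Real.log n + Real.log Vmax + Real.log Q + E + Real.log (2 * Q) ≤
      (14 * n + 3) * (W + E + Real.log (2 * Vmax)) := by
  have hΩ : 0 < ∏ j, V j := prod_pos fun j _ => by linarith [hV1 j]
  have hn1 : (1 : ℝ) ≤ n := by exact_mod_cast hn
  have hlogA : 0 ≤ Real.log Vmax := Real.log_nonneg hVmax1
  have hlog2 : Real.log 2 < 0.6931471808 := Real.log_two_lt_d9
  have hlog2' : 0 < Real.log 2 := by have := Real.log_two_gt_d9; linarith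
  have hlog3 : Real.log 3 ≤ 2 := by
    have := Real.log_le_sub_one_of_pos (show (0 : ℝ) < 3 by norm_num); linarith
  have hlogn : Real.log n ≤ n := by
    have := Real.log_le_sub_one_of_pos (show (0 : ℝ) < n by linarith); linarith
  have hlogΩ : Real.log (∏ j, V j) ≤ n * Real.log Vmax := by
    have h := Real.log_le_log hΩ (prod_le_pow_of (fun j => by linarith [hV1 j]) hVmax)
    rwa [Real.log_pow] at h
  have hQ1 : Q ≤ (256 : ℝ) ^ (n - r) * ∏ j, V j := by nlinarith
  have hlogQ : Real.log Q ≤ 5.6 * n + n * Real.log Vmax := by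
    have h := Real.log_le_log hQ0 hQ1
    rw [Real.log_mul (by positivity) hΩ.ne', Real.log_pow] at h
    have h256 : Real.log 256 = 8 * Real.log 2 := by
      rw [show (256 : ℝ) = 2 ^ 8 by norm_num, Real.log_pow]; norm_num
    rw [h256] at h
    have hnr : ((n - r : ℕ) : ℝ) ≤ n := by exact_mod_cast Nat.sub_le n r
    have : ((n - r : ℕ) : ℝ) * (8 * Real.log 2) ≤ n * 5.6 := by nlinarith
    linarith
  have hlog2Q : Real.log (2 * Q) ≤ 0.7 + 5.6 * n + n * Real.log Vmax := by
    rw [Real.log_mul (by norm_num) hQ0.ne']; linarith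
  have hlog2A : Real.log (2 * Vmax) = Real.log 2 + Real.log Vmax := by
    rw [Real.log_mul (by norm_num) (by linarith)]
  rw [hlog2A]
  have hn0 : (0 : ℝ) ≤ n := by linarith
  have t1 : (n : ℝ) ≤ (n : ℝ) * W := by nlinarith
  have t2 : 0 ≤ (n : ℝ) * E := mul_nonneg hn0 hE
  have t3 : 0 ≤ (n : ℝ) * Real.log Vmax := mul_nonneg hn0 hlogA
  have t4 : 0 ≤ (n : ℝ) * Real.log 2 := mul_nonneg hn0 hlog2'.le
  have e : (14 * (n : ℝ) + 3) * (W + E + (Real.log 2 + Real.log Vmax)) =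
      14 * ((n : ℝ) * W) + 3 * W + 14 * ((n : ℝ) * E) + 3 * E + 14 * ((n : ℝ) * Real.log 2) +
        3 * Real.log 2 + 14 * ((n : ℝ) * Real.log Vmax) + 3 * Real.log Vmax := by ring
  rw [e]
  linarith

/-- The final step of clause (C), generic weights. [cite: Nesterenko2003, §5.2 (5.22)] -/
theorem clauseC_final_of {n : ℕ} (hn : 1 ≤ n) {V : Fin n → ℝ} {Vmax W : ℝ} (hV1 : ∀ j, 1 ≤ V j)
    (hVmax : ∀ j, V j ≤ Vmax) (hVmax1 : 1 ≤ Vmax) (hW : 1 ≤ W)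
    {C : ℕ → ℝ} (hC0 : ∀ r, 0 ≤ C r) (hCg : ∀ r, r < n → (256 : ℝ) ^ (n - r) * C r ≤ C n)
    {r : ℕ} (hr : r < n) {Q E : ℝ} (hQ0 : 0 < Q) (hE : 0 ≤ E)
    (hQ : Q * (14 * n + 3) ≤ (256 : ℝ) ^ (n - r) * ∏ j, V j) :
    C r * Q * (W + Real.log 3 + Real.log n + Real.log Vmax + Real.log Q + E + Real.log (2 * Q)) ≤
      C n * (∏ j, V j) * (W + E + Real.log (2 * Vmax)) := by
  have hB := bracket_le_of hn hV1 hVmax hVmax1 hW hQ0 hE hQ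
  have hΩ : 0 < ∏ j, V j := prod_pos fun j _ => by linarith [hV1 j]
  have hCr := hC0 r
  have hCn := hC0 n
  have hpos : 0 < W + E + Real.log (2 * Vmax) := by
    have h2 : 0 ≤ Real.log (2 * Vmax) := Real.log_nonneg (by linarith)
    linarith
  by_cases hneg : W + Real.log 3 + Real.log n + Real.log Vmax + Real.log Q + E + Real.log (2 * Q) ≤ 0
  · calc C r * Q * (W + Real.log 3 + Real.log n + Real.log Vmax + Real.log Q + E + Real.log (2 * Q))
        ≤ 0 := mul_nonpos_of_nonneg_of_nonpos (mul_nonneg hCr hQ0.le) hneg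
      _ ≤ C n * (∏ j, V j) * (W + E + Real.log (2 * Vmax)) := by positivity
  · push Not at hneg
    calc C r * Q * (W + Real.log 3 + Real.log n + Real.log Vmax + Real.log Q + E + Real.log (2 * Q))
        ≤ C r * Q * ((14 * n + 3) * (W + E + Real.log (2 * Vmax))) :=
          mul_le_mul_of_nonneg_left hB (mul_nonneg hCr hQ0.le)
      _ = C r * (Q * (14 * n + 3)) * (W + E + Real.log (2 * Vmax)) := by ring
      _ ≤ C r * ((256 : ℝ) ^ (n - r) * ∏ j, V j) * (W + E + Real.log (2 * Vmax)) := by gcongr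
      _ = ((256 : ℝ) ^ (n - r) * C r) * (∏ j, V j) * (W + E + Real.log (2 * Vmax)) := by ring
      _ ≤ C n * (∏ j, V j) * (W + E + Real.log (2 * Vmax)) := by gcongr; exact hCg r hr

/-- The END denominators are positive (generic). [folklore] -/
theorem den_pos_of {n S₀ Xf D₀ : ℕ} (hD₀ : 1 ≤ D₀) (r d₀ : ℕ) :
    (0 : ℝ) < ((Nat.choose (S₀ + (r - d₀)) (r - d₀) * (2 * Xf + 1) *
      ((d₀ + (n - r))! * 2 ^ (n - r) * D₀ ^ d₀) : ℕ) : ℝ) := by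
  have h1 : 0 < Nat.choose (S₀ + (r - d₀)) (r - d₀) := Nat.choose_pos (Nat.le_add_left _ _)
  have h2 : 0 < (d₀ + (n - r))! := Nat.factorial_pos _
  have h3 : 0 < D₀ ^ d₀ := pow_pos (by omega) _
  positivity

/-- Positivity of `Pmax` (generic). [folklore] -/
theorem Q_pos_of {n S₀ Xf D₀ : ℕ} (hn : 1 ≤ n) (hD₀ : 1 ≤ D₀) {Λ : ℝ} (hΛ : 0 < Λ) (r d₀ : ℕ) :
    0 < ((r ! : ℕ) : ℝ) ^ 2 * (n : ℝ) ^ r *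
        (((((n + 1)! * 2 ^ n * D₀ : ℕ) : ℝ) * Λ ^ r /
          ((Nat.choose (S₀ + (r - d₀)) (r - d₀) * (2 * Xf + 1) *
            ((d₀ + (n - r))! * 2 ^ (n - r) * D₀ ^ d₀) : ℕ) : ℝ))) := by
  have hden := den_pos_of (n := n) (S₀ := S₀) (Xf := Xf) hD₀ r d₀
  have hnr : (0 : ℝ) < n := by exact_mod_cast hn
  have hr : (0 : ℝ) < ((r ! : ℕ) : ℝ) := by exact_mod_cast Nat.factorial_pos r
  have hN : (0 : ℝ) < (((n + 1)! * 2 ^ n * D₀ : ℕ) : ℝ) := by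
    have : 0 < D₀ := by omega
    positivity
  positivity

/-- `ℓ!·C(S₀+ℓ, ℓ) ≥ (S₀+1)^ℓ` in `ℝ`. [folklore] -/
theorem pow_le_factorial_mul_choose_real (S₀ ℓ : ℕ) :
    ((S₀ : ℝ) + 1) ^ ℓ ≤ ((ℓ ! : ℕ) : ℝ) * ((Nat.choose (S₀ + ℓ) ℓ : ℕ) : ℝ) := by
  have h := pow_le_factorial_mul_choose S₀ ℓ
  have : ((((S₀ + 1) ^ ℓ : ℕ)) : ℝ) ≤ ((ℓ ! * (S₀ + ℓ).choose ℓ : ℕ) : ℝ) := by exact_mod_cast h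
  push_cast at this; exact this

/-- **Clause (C) core, `d₀ = 1`**: p4's `Pmax(r,1)·(14n+3) ≤ 256^{n−r}Ω` from the constant comparison
`NC1 r : (r!)²nʳ(n+1)!2ʳ(r−1)!·λʳ·c_L·(14n+3) ≤ 256^{n−r}σ^{r−1}2^{n+22}(n−r+1)!`
(`λ = (2^{n+23})⁻¹ + 2ⁿ/(24Cbⁿ)`, `c_L = 264Cbⁿ + 2^{2n+26}`, `σ = 16(n+1)/(n+2)⁴`).
[cite: Nesterenko2003, §5.2 (5.21)–(5.22)] -/
theorem Q_mul_le_one_of {n : ℕ} (hn : 1 ≤ n) {V : Fin n → ℝ} (hV1 : ∀ j, 1 ≤ V j)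
    {L K X Λ : ℝ} (hL : 0 < L) (hX1 : 1 ≤ X) (hΛ0 : 0 ≤ Λ)
    {S₀ Xf D₀ : ℕ} (hD₀1 : 1 ≤ D₀)
    (hs : 16 * ((n : ℝ) + 1) * L < ((S₀ : ℝ) + 1) * ((n : ℝ) + 2) ^ 4)
    (hxfK : (2 : ℝ) ^ (n + 22) * K * X ≤ 2 * (Xf : ℝ) + 1)
    (hΛL : Λ ≤ (((2 : ℝ) ^ (n + 23))⁻¹ + 2 ^ n / (24 * Cb ^ n)) * L)
    (hLKΩ : L ≤ (264 * Cb ^ n + 2 ^ (2 * n + 26)) * K * ∏ j, V j)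
    {r : ℕ} (hr0 : 0 < r) (hrn : r < n) :
    ((r ! : ℕ) : ℝ) ^ 2 * (n : ℝ) ^ r *
        (((((n + 1)! * 2 ^ n * D₀ : ℕ) : ℝ) * Λ ^ r /
          ((Nat.choose (S₀ + (r - 1)) (r - 1) * (2 * Xf + 1) *
            ((1 + (n - r))! * 2 ^ (n - r) * D₀ ^ 1) : ℕ) : ℝ))) * (14 * n + 3) ≤
      (256 : ℝ) ^ (n - r) * ∏ j, V j := by
  have hnum := hnum1_holds n r hr0 hrn
  have hΩ : 0 < ∏ j, V j := prod_pos fun j _ => by linarith [hV1 j]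
  have hσL : (16 * ((n : ℝ) + 1) / ((n : ℝ) + 2) ^ 4) * L ≤ (S₀ : ℝ) + 1 := by
    rw [div_mul_eq_mul_div, div_le_iff₀ (by positivity)]; nlinarith
  have hchoose := pow_le_factorial_mul_choose_real S₀
  set lam : ℝ := ((2 : ℝ) ^ (n + 23))⁻¹ + 2 ^ n / (24 * Cb ^ n) with hlam
  set cL : ℝ := 264 * Cb ^ n + 2 ^ (2 * n + 26) with hcL
  set σ : ℝ := 16 * ((n : ℝ) + 1) / ((n : ℝ) + 2) ^ 4 with hσ
  have hCb : (0 : ℝ) < Cb ^ n := by have := sixtyfour_le_Cb; positivity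
  have hσ0 : 0 < σ := by positivity
  have hcL0 : 0 < cL := by positivity
  have hΛr : Λ ^ r ≤ (lam * L) ^ r := pow_le_pow_left₀ hΛ0 hΛL r
  have hch := hchoose (r - 1)
  have hden := den_pos_of (n := n) (S₀ := S₀) (Xf := Xf) hD₀1 r 1
  have e1 : 1 + (n - r) = n - r + 1 := by omega
  simp only [e1, pow_one] at hden ⊢
  rw [mul_div_assoc', div_mul_eq_mul_div, div_le_iff₀ hden]
  push_cast
  have h2n : (2 : ℝ) ^ n = 2 ^ r * 2 ^ (n - r) := by rw [← pow_add, Nat.add_sub_cancel' hrn.le]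
  have hLr : L ^ r = L ^ (r - 1) * L := by rw [← pow_succ, Nat.sub_add_cancel hr0]
  have hr1fac : (0 : ℝ) < (((r - 1)! : ℕ) : ℝ) := by exact_mod_cast Nat.factorial_pos _
  -- the scale factor
  set S : ℝ := L ^ r * 2 ^ (n - r) * (D₀ : ℝ) with hS
  have hD₀pos : (0 : ℝ) < D₀ := by exact_mod_cast (show 0 < D₀ by omega)
  have hS0 : 0 < S := by rw [hS]; positivity
  -- (1) numerator ≤ (numeric LHS) · S / ((r-1)! cL), written multiplicatively
  have step1 : ((r ! : ℕ) : ℝ) ^ 2 * (n : ℝ) ^ r * ((((n + 1)! : ℕ) : ℝ) * 2 ^ n * (D₀ : ℝ) * Λ ^ r) *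
        (14 * n + 3) * ((((r - 1)! : ℕ) : ℝ) * cL) ≤
      (((r ! : ℕ) : ℝ) ^ 2 * (n : ℝ) ^ r * (((n + 1)! : ℕ) : ℝ) * 2 ^ r * (((r - 1)! : ℕ) : ℝ) *
          lam ^ r * cL * (14 * n + 3)) * S := by
    have h1 : ((((n + 1)! : ℕ) : ℝ) * 2 ^ n * (D₀ : ℝ) * Λ ^ r) ≤
        (((n + 1)! : ℕ) : ℝ) * 2 ^ n * (D₀ : ℝ) * (lam * L) ^ r :=
      mul_le_mul_of_nonneg_left hΛr (by positivity)
    calc ((r ! : ℕ) : ℝ) ^ 2 * (n : ℝ) ^ r * ((((n + 1)! : ℕ) : ℝ) * 2 ^ n * (D₀ : ℝ) * Λ ^ r) *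
          (14 * n + 3) * ((((r - 1)! : ℕ) : ℝ) * cL)
        ≤ ((r ! : ℕ) : ℝ) ^ 2 * (n : ℝ) ^ r * ((((n + 1)! : ℕ) : ℝ) * 2 ^ n * (D₀ : ℝ) * (lam * L) ^ r) *
          (14 * n + 3) * ((((r - 1)! : ℕ) : ℝ) * cL) := by gcongr
      _ = (((r ! : ℕ) : ℝ) ^ 2 * (n : ℝ) ^ r * (((n + 1)! : ℕ) : ℝ) * 2 ^ r * (((r - 1)! : ℕ) : ℝ) *
          lam ^ r * cL * (14 * n + 3)) * S := by rw [hS, h2n, mul_pow]; ring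
  -- (2) numeric comparison, scaled by `S`
  have step2 : (((r ! : ℕ) : ℝ) ^ 2 * (n : ℝ) ^ r * (((n + 1)! : ℕ) : ℝ) * 2 ^ r * (((r - 1)! : ℕ) : ℝ) *
          lam ^ r * cL * (14 * n + 3)) * S ≤
      ((256 : ℝ) ^ (n - r) * σ ^ (r - 1) * 2 ^ (n + 22) * (((n - r + 1)! : ℕ) : ℝ)) * S :=
    mul_le_mul_of_nonneg_right hnum hS0.le
  -- (3) `σ^{r-1} L^{r-1} ≤ (r-1)! choose`, `L ≤ cL K Ω`, `2^{n+22} K ≤ xf`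
  have hσpow : (σ * L) ^ (r - 1) ≤ (((r - 1)! : ℕ) : ℝ) * ((Nat.choose (S₀ + (r - 1)) (r - 1) : ℕ) : ℝ) :=
    (pow_le_pow_left₀ (by positivity) hσL _).trans hch
  have hK1 : (2 : ℝ) ^ (n + 22) * K ≤ 2 * (Xf : ℝ) + 1 := by nlinarith
  have step3 : ((256 : ℝ) ^ (n - r) * σ ^ (r - 1) * 2 ^ (n + 22) * (((n - r + 1)! : ℕ) : ℝ)) * S ≤
      (256 : ℝ) ^ (n - r) * (∏ j, V j) * (((Nat.choose (S₀ + (r - 1)) (r - 1) : ℕ) : ℝ) *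
        (2 * (Xf : ℝ) + 1) * ((((n - r + 1)! : ℕ) : ℝ) * 2 ^ (n - r) * (D₀ : ℝ))) *
        ((((r - 1)! : ℕ) : ℝ) * cL) := by
    calc ((256 : ℝ) ^ (n - r) * σ ^ (r - 1) * 2 ^ (n + 22) * (((n - r + 1)! : ℕ) : ℝ)) * S
        = (256 : ℝ) ^ (n - r) * (σ * L) ^ (r - 1) * L * (2 ^ (n + 22)) *
            ((((n - r + 1)! : ℕ) : ℝ) * 2 ^ (n - r) * (D₀ : ℝ)) := by rw [hS, hLr, mul_pow]; ring
      _ ≤ (256 : ℝ) ^ (n - r) * ((((r - 1)! : ℕ) : ℝ) * ((Nat.choose (S₀ + (r - 1)) (r - 1) : ℕ) : ℝ)) *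
            (cL * K * ∏ j, V j) * (2 ^ (n + 22)) * ((((n - r + 1)! : ℕ) : ℝ) * 2 ^ (n - r) * (D₀ : ℝ)) := by
          gcongr
      _ = (256 : ℝ) ^ (n - r) * (∏ j, V j) * (((Nat.choose (S₀ + (r - 1)) (r - 1) : ℕ) : ℝ) *
            (2 ^ (n + 22) * K) * ((((n - r + 1)! : ℕ) : ℝ) * 2 ^ (n - r) * (D₀ : ℝ))) *
            ((((r - 1)! : ℕ) : ℝ) * cL) := by ring
      _ ≤ (256 : ℝ) ^ (n - r) * (∏ j, V j) * (((Nat.choose (S₀ + (r - 1)) (r - 1) : ℕ) : ℝ) *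
            (2 * (Xf : ℝ) + 1) * ((((n - r + 1)! : ℕ) : ℝ) * 2 ^ (n - r) * (D₀ : ℝ))) *
            ((((r - 1)! : ℕ) : ℝ) * cL) := by gcongr
  exact le_of_mul_le_mul_right (step1.trans (step2.trans step3)) (by positivity)

/-- **Clause (C) core, `d₀ = 0`**: p4's `Pmax(r,0)·(14n+3) ≤ 256^{n−r}Ω` from
`NC0 r : (r!)³nʳ(n+1)!2^{r−1}·λʳ·c_L·(14n+3) ≤ 256^{n−r}σʳ2^{n+22}(n−r)!`; here `D₀ ≤ X L/2` cancels the
`X` of `2X_fin + 1 ≥ 2^{n+22}K·X`. [cite: Nesterenko2003, §5.2 (5.21)–(5.22)] -/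
theorem Q_mul_le_zero_of {n : ℕ} (hn : 1 ≤ n) {V : Fin n → ℝ} (hV1 : ∀ j, 1 ≤ V j)
    {L K X Λ : ℝ} (hL : 0 < L) (hX1 : 1 ≤ X) (hΛ0 : 0 ≤ Λ)
    {S₀ Xf D₀ : ℕ} (hD₀1 : 1 ≤ D₀) (hD₀ : (D₀ : ℝ) ≤ X * L / 2)
    (hs : 16 * ((n : ℝ) + 1) * L < ((S₀ : ℝ) + 1) * ((n : ℝ) + 2) ^ 4)
    (hxfK : (2 : ℝ) ^ (n + 22) * K * X ≤ 2 * (Xf : ℝ) + 1)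
    (hΛL : Λ ≤ (((2 : ℝ) ^ (n + 23))⁻¹ + 2 ^ n / (24 * Cb ^ n)) * L)
    (hLKΩ : L ≤ (264 * Cb ^ n + 2 ^ (2 * n + 26)) * K * ∏ j, V j)
    {r : ℕ} (hr0 : 0 < r) (hrn : r < n) :
    ((r ! : ℕ) : ℝ) ^ 2 * (n : ℝ) ^ r *
        (((((n + 1)! * 2 ^ n * D₀ : ℕ) : ℝ) * Λ ^ r /
          ((Nat.choose (S₀ + (r - 0)) (r - 0) * (2 * Xf + 1) *
            ((0 + (n - r))! * 2 ^ (n - r) * D₀ ^ 0) : ℕ) : ℝ))) * (14 * n + 3) ≤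
      (256 : ℝ) ^ (n - r) * ∏ j, V j := by
  have hnum := hnum0_holds n r hr0 hrn
  have hΩ : 0 < ∏ j, V j := prod_pos fun j _ => by linarith [hV1 j]
  have hσL : (16 * ((n : ℝ) + 1) / ((n : ℝ) + 2) ^ 4) * L ≤ (S₀ : ℝ) + 1 := by
    rw [div_mul_eq_mul_div, div_le_iff₀ (by positivity)]; nlinarith
  have hchoose := pow_le_factorial_mul_choose_real S₀
  set lam : ℝ := ((2 : ℝ) ^ (n + 23))⁻¹ + 2 ^ n / (24 * Cb ^ n) with hlam
  set cL : ℝ := 264 * Cb ^ n + 2 ^ (2 * n + 26) with hcL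
  set σ : ℝ := 16 * ((n : ℝ) + 1) / ((n : ℝ) + 2) ^ 4 with hσ
  have hCb : (0 : ℝ) < Cb ^ n := by have := sixtyfour_le_Cb; positivity
  have hσ0 : 0 < σ := by positivity
  have hcL0 : 0 < cL := by positivity
  have hΛr : Λ ^ r ≤ (lam * L) ^ r := pow_le_pow_left₀ hΛ0 hΛL r
  have hch := hchoose r
  have hden := den_pos_of (n := n) (S₀ := S₀) (Xf := Xf) hD₀1 r 0
  simp only [Nat.sub_zero, zero_add, pow_zero, mul_one] at hden ⊢
  rw [mul_div_assoc', div_mul_eq_mul_div, div_le_iff₀ hden]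
  push_cast
  have h2n : (2 : ℝ) ^ n = 2 ^ (r - 1) * 2 * 2 ^ (n - r) := by
    rw [← pow_succ, Nat.sub_add_cancel hr0, ← pow_add, Nat.add_sub_cancel' hrn.le]
  have hrfac : (0 : ℝ) < ((r ! : ℕ) : ℝ) := by exact_mod_cast Nat.factorial_pos _
  set S : ℝ := X * L ^ (r + 1) * 2 ^ (n - r) with hS
  have hS0 : 0 < S := by positivity
  -- (1)
  have step1 : ((r ! : ℕ) : ℝ) ^ 2 * (n : ℝ) ^ r * ((((n + 1)! : ℕ) : ℝ) * 2 ^ n * (D₀ : ℝ) * Λ ^ r) *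
        (14 * n + 3) * (((r ! : ℕ) : ℝ) * cL) ≤
      (((r ! : ℕ) : ℝ) ^ 3 * (n : ℝ) ^ r * (((n + 1)! : ℕ) : ℝ) * 2 ^ (r - 1) * lam ^ r * cL *
          (14 * n + 3)) * S := by
    calc ((r ! : ℕ) : ℝ) ^ 2 * (n : ℝ) ^ r * ((((n + 1)! : ℕ) : ℝ) * 2 ^ n * (D₀ : ℝ) * Λ ^ r) *
          (14 * n + 3) * (((r ! : ℕ) : ℝ) * cL)
        ≤ ((r ! : ℕ) : ℝ) ^ 2 * (n : ℝ) ^ r * ((((n + 1)! : ℕ) : ℝ) * 2 ^ n * (X * L / 2) * (lam * L) ^ r) *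
          (14 * n + 3) * (((r ! : ℕ) : ℝ) * cL) := by gcongr
      _ = (((r ! : ℕ) : ℝ) ^ 3 * (n : ℝ) ^ r * (((n + 1)! : ℕ) : ℝ) * 2 ^ (r - 1) * lam ^ r * cL *
          (14 * n + 3)) * S := by rw [hS, h2n, mul_pow]; ring
  -- (2)
  have step2 : (((r ! : ℕ) : ℝ) ^ 3 * (n : ℝ) ^ r * (((n + 1)! : ℕ) : ℝ) * 2 ^ (r - 1) * lam ^ r * cL *
          (14 * n + 3)) * S ≤
      ((256 : ℝ) ^ (n - r) * σ ^ r * 2 ^ (n + 22) * (((n - r)! : ℕ) : ℝ)) * S :=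
    mul_le_mul_of_nonneg_right hnum hS0.le
  -- (3)
  have hσpow : (σ * L) ^ r ≤ ((r ! : ℕ) : ℝ) * ((Nat.choose (S₀ + r) r : ℕ) : ℝ) :=
    (pow_le_pow_left₀ (by positivity) hσL _).trans hch
  have step3 : ((256 : ℝ) ^ (n - r) * σ ^ r * 2 ^ (n + 22) * (((n - r)! : ℕ) : ℝ)) * S ≤
      (256 : ℝ) ^ (n - r) * (∏ j, V j) * (((Nat.choose (S₀ + r) r : ℕ) : ℝ) * (2 * (Xf : ℝ) + 1) *
        ((((n - r)! : ℕ) : ℝ) * 2 ^ (n - r))) * (((r ! : ℕ) : ℝ) * cL) := by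
    calc ((256 : ℝ) ^ (n - r) * σ ^ r * 2 ^ (n + 22) * (((n - r)! : ℕ) : ℝ)) * S
        = (256 : ℝ) ^ (n - r) * (σ * L) ^ r * L * (2 ^ (n + 22) * X) *
            ((((n - r)! : ℕ) : ℝ) * 2 ^ (n - r)) := by rw [hS, mul_pow, pow_succ]; ring
      _ ≤ (256 : ℝ) ^ (n - r) * (((r ! : ℕ) : ℝ) * ((Nat.choose (S₀ + r) r : ℕ) : ℝ)) *
            (cL * K * ∏ j, V j) * (2 ^ (n + 22) * X) * ((((n - r)! : ℕ) : ℝ) * 2 ^ (n - r)) := by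
          gcongr
      _ = (256 : ℝ) ^ (n - r) * (∏ j, V j) * (((Nat.choose (S₀ + r) r : ℕ) : ℝ) *
            (2 ^ (n + 22) * K * X) * ((((n - r)! : ℕ) : ℝ) * 2 ^ (n - r))) * (((r ! : ℕ) : ℝ) * cL) := by
          ring
      _ ≤ (256 : ℝ) ^ (n - r) * (∏ j, V j) * (((Nat.choose (S₀ + r) r : ℕ) : ℝ) *
            (2 * (Xf : ℝ) + 1) * ((((n - r)! : ℕ) : ℝ) * 2 ^ (n - r))) * (((r ! : ℕ) : ℝ) * cL) := by
          gcongr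
  exact le_of_mul_le_mul_right (step1.trans (step2.trans step3)) (by positivity)

/-- **Clause (C), `p = 2` shape, from the six scalar facts** (hypothesis `hCineq` of
`RecordAssembly.recordTwo_of_ineqs` for `(V, Vmax, W, D₀, S₀, X_f, Λ)`). [cite: Nesterenko2003, §5.2 (5.22)] -/
theorem exitC_two_of {n : ℕ} (hn : 1 ≤ n) {V : Fin n → ℝ} {Vmax W : ℝ} (hV1 : ∀ j, 1 ≤ V j)
    (hVmax : ∀ j, V j ≤ Vmax) (hVmax1 : 1 ≤ Vmax) (hW : 1 ≤ W)
    {L K X Λ : ℝ} (hL : 0 < L) (hX1 : 1 ≤ X) (hΛ : 0 < Λ)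
    {S₀ Xf D₀ : ℕ} (hD₀1 : 1 ≤ D₀) (hD₀ : (D₀ : ℝ) ≤ X * L / 2)
    (hs : 16 * ((n : ℝ) + 1) * L < ((S₀ : ℝ) + 1) * ((n : ℝ) + 2) ^ 4)
    (hxfK : (2 : ℝ) ^ (n + 22) * K * X ≤ 2 * (Xf : ℝ) + 1)
    (hΛL : Λ ≤ (((2 : ℝ) ^ (n + 23))⁻¹ + 2 ^ n / (24 * Cb ^ n)) * L)
    (hLKΩ : L ≤ (264 * Cb ^ n + 2 ^ (2 * n + 26)) * K * ∏ j, V j)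
    {C : ℕ → ℝ} (hC0 : ∀ r, 0 ≤ C r) (hCg : ∀ r, r < n → (256 : ℝ) ^ (n - r) * C r ≤ C n) :
    ∀ r d₀ : ℕ, 0 < r → r < n → d₀ ≤ 1 →
      C r * (((r.factorial : ℝ)) ^ 2 * (n : ℝ) ^ r *
              ((((n + 1).factorial * 2 ^ n * D₀ : ℕ) : ℝ) * Λ ^ r /
                ((Nat.choose (S₀ + (r - d₀)) (r - d₀) * (2 * Xf + 1) *
                  ((d₀ + (n - r)).factorial * 2 ^ (n - r) * D₀ ^ d₀) : ℕ) : ℝ))) *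
          (W + Real.log 3 + Real.log n + Real.log Vmax +
            Real.log (((r.factorial : ℝ)) ^ 2 * (n : ℝ) ^ r *
              ((((n + 1).factorial * 2 ^ n * D₀ : ℕ) : ℝ) * Λ ^ r /
                ((Nat.choose (S₀ + (r - d₀)) (r - d₀) * (2 * Xf + 1) *
                  ((d₀ + (n - r)).factorial * 2 ^ (n - r) * D₀ ^ d₀) : ℕ) : ℝ))) +
            Real.log (2 * (((r.factorial : ℝ)) ^ 2 * (n : ℝ) ^ r *
              ((((n + 1).factorial * 2 ^ n * D₀ : ℕ) : ℝ) * Λ ^ r /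
                ((Nat.choose (S₀ + (r - d₀)) (r - d₀) * (2 * Xf + 1) *
                  ((d₀ + (n - r)).factorial * 2 ^ (n - r) * D₀ ^ d₀) : ℕ) : ℝ))))) ≤
        C n * (∏ j, V j) * (W + Real.log (2 * Vmax)) := by
  intro r d₀ hr0 hrn hd₀
  have hQ0 := Q_pos_of (n := n) (S₀ := S₀) (Xf := Xf) hn hD₀1 hΛ r d₀
  have hQ : ((r ! : ℕ) : ℝ) ^ 2 * (n : ℝ) ^ r *
        (((((n + 1)! * 2 ^ n * D₀ : ℕ) : ℝ) * Λ ^ r /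
          ((Nat.choose (S₀ + (r - d₀)) (r - d₀) * (2 * Xf + 1) *
            ((d₀ + (n - r))! * 2 ^ (n - r) * D₀ ^ d₀) : ℕ) : ℝ))) * (14 * n + 3) ≤
      (256 : ℝ) ^ (n - r) * ∏ j, V j := by
    rcases Nat.le_one_iff_eq_zero_or_eq_one.mp hd₀ with rfl | rfl
    · exact Q_mul_le_zero_of hn hV1 hL hX1 hΛ.le hD₀1 hD₀ hs hxfK hΛL hLKΩ hr0 hrn
    · exact Q_mul_le_one_of hn hV1 hL hX1 hΛ.le hD₀1 hs hxfK hΛL hLKΩ hr0 hrn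
  have h := clauseC_final_of hn hV1 hVmax hVmax1 hW hC0 hCg hrn hQ0 le_rfl hQ
  simpa only [add_zero] using h

/-- **Clause (C), odd-`p` shape (`+ log p`), from the six scalar facts** (hypothesis `hCineq` of
`RecordAssembly.recordOdd_of_ineqs`). [cite: Nesterenko2003, §5.2 (5.22)] -/
theorem exitC_odd_of {n : ℕ} (hn : 1 ≤ n) {V : Fin n → ℝ} {Vmax W : ℝ} (hV1 : ∀ j, 1 ≤ V j)
    (hVmax : ∀ j, V j ≤ Vmax) (hVmax1 : 1 ≤ Vmax) (hW : 1 ≤ W)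
    {L K X Λ : ℝ} (hL : 0 < L) (hX1 : 1 ≤ X) (hΛ : 0 < Λ)
    {S₀ Xf D₀ : ℕ} (hD₀1 : 1 ≤ D₀) (hD₀ : (D₀ : ℝ) ≤ X * L / 2)
    (hs : 16 * ((n : ℝ) + 1) * L < ((S₀ : ℝ) + 1) * ((n : ℝ) + 2) ^ 4)
    (hxfK : (2 : ℝ) ^ (n + 22) * K * X ≤ 2 * (Xf : ℝ) + 1)
    (hΛL : Λ ≤ (((2 : ℝ) ^ (n + 23))⁻¹ + 2 ^ n / (24 * Cb ^ n)) * L)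
    (hLKΩ : L ≤ (264 * Cb ^ n + 2 ^ (2 * n + 26)) * K * ∏ j, V j)
    (p : ℕ) {C : ℕ → ℝ} (hC0 : ∀ r, 0 ≤ C r) (hCg : ∀ r, r < n → (256 : ℝ) ^ (n - r) * C r ≤ C n) :
    ∀ r d₀ : ℕ, 0 < r → r < n → d₀ ≤ 1 →
      C r * (((r.factorial : ℝ)) ^ 2 * (n : ℝ) ^ r *
              ((((n + 1).factorial * 2 ^ n * D₀ : ℕ) : ℝ) * Λ ^ r /
                ((Nat.choose (S₀ + (r - d₀)) (r - d₀) * (2 * Xf + 1) *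
                  ((d₀ + (n - r)).factorial * 2 ^ (n - r) * D₀ ^ d₀) : ℕ) : ℝ))) *
          (W + Real.log 3 + Real.log n + Real.log Vmax +
            Real.log (((r.factorial : ℝ)) ^ 2 * (n : ℝ) ^ r *
              ((((n + 1).factorial * 2 ^ n * D₀ : ℕ) : ℝ) * Λ ^ r /
                ((Nat.choose (S₀ + (r - d₀)) (r - d₀) * (2 * Xf + 1) *
                  ((d₀ + (n - r)).factorial * 2 ^ (n - r) * D₀ ^ d₀) : ℕ) : ℝ))) +
            Real.log p +
            Real.log (2 * (((r.factorial : ℝ)) ^ 2 * (n : ℝ) ^ r *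
              ((((n + 1).factorial * 2 ^ n * D₀ : ℕ) : ℝ) * Λ ^ r /
                ((Nat.choose (S₀ + (r - d₀)) (r - d₀) * (2 * Xf + 1) *
                  ((d₀ + (n - r)).factorial * 2 ^ (n - r) * D₀ ^ d₀) : ℕ) : ℝ))))) ≤
        C n * (∏ j, V j) * (W + Real.log p + Real.log (2 * Vmax)) := by
  intro r d₀ hr0 hrn hd₀
  have hQ0 := Q_pos_of (n := n) (S₀ := S₀) (Xf := Xf) hn hD₀1 hΛ r d₀
  have hQ : ((r ! : ℕ) : ℝ) ^ 2 * (n : ℝ) ^ r *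
        (((((n + 1)! * 2 ^ n * D₀ : ℕ) : ℝ) * Λ ^ r /
          ((Nat.choose (S₀ + (r - d₀)) (r - d₀) * (2 * Xf + 1) *
            ((d₀ + (n - r))! * 2 ^ (n - r) * D₀ ^ d₀) : ℕ) : ℝ))) * (14 * n + 3) ≤
      (256 : ℝ) ^ (n - r) * ∏ j, V j := by
    rcases Nat.le_one_iff_eq_zero_or_eq_one.mp hd₀ with rfl | rfl
    · exact Q_mul_le_zero_of hn hV1 hL hX1 hΛ.le hD₀1 hD₀ hs hxfK hΛL hLKΩ hr0 hrn
    · exact Q_mul_le_one_of hn hV1 hL hX1 hΛ.le hD₀1 hs hxfK hΛL hLKΩ hr0 hrn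
  exact clauseC_final_of hn hV1 hVmax hVmax1 hW hC0 hCg hrn hQ0 (Real.log_natCast_nonneg p) hQ

end RecordExitsNumeric

end Summit.ABC.StewartYu

end
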